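import Mathlib.LinearAlgebra.Matrix.Determinant.Basic
import Mathlib.GroupTheory.Perm.Fin
import Mathlib.Data.Finset.Sort
import Mathlib.Tactic.LinearCombination
import Mathlib.Algebra.Order.Ring.Defs
import Mathlib.Algebra.Order.GroupWithZero.Basic
import HarnessLib

/-!
# Fekete's criterion: contiguous minors decide (multiple) total positivity — proved

Trunk T-ANALYSIS (Literature/Analysis/TotalPositivity). Leaf D1 of the decomposition of the named
fact `Literature.NumberTheory.LFunctions.katkova_apf` (Katkova 2006, Thm. 2: `ξ₁ ∈ APF_m` for all `m`,
`Literature/NumberTheory/LFunctions/XiMultiplePositivity.lean`): Katkova [Katkova2006, §2, arXiv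
p. 5] derives Thm. 2 from her Prop. 1 (positivity of the CONSECUTIVE Toeplitz minors
`A_k^ν = det (a_{k+j-l})_{l,j<ν}` for `k ≥ N(m)`, `ν ≤ m`) through

> **Theorem D** (Schoenberg [Ann. Math. 62 (1955) 447–471]). *If all minors of order
> `ν = 1, 2, …, m` composed of consecutive rows and consecutive columns of matrix `A` are
> positive then all minors of `A` of order `ν = 1, 2, …, m` are positive.*

This is Fekete's criterion (M. Fekete 1912), printed e.g. as [FallatJohnson2011, Cor. 3.1.5
("If all contiguous minors of `A ∈ M_{m,n}` are positive, then `A` is TP") and Cor. 3.1.6 (the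
`TP_k` version), p. 77]. We prove it here for matrices `A : Matrix (Fin p) (Fin q) R` over a
linearly ordered commutative ring, minors being `(A.submatrix r c).det` for strictly increasing
selections `r : Fin k → Fin p`, `c : Fin k → Fin q` (the convention of
`Literature/Analysis/TotalPositivity/PolyaFrequency.lean`).

## The proof

The classical induction on the order `k` and on the *dispersion* (number of skipped indices) of
the row and column selections. The algebraic input is a three-term Plücker identity
(`det_mul_det_eq_add`): for an `(n+2) × (n+3)` matrix `M`, writing `[t̂]` for the maximal minor
omitting column `t` and `{t̂ t̂'}` for the maximal minor of the first `n + 1` rows omitting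
columns `t, t'`, one has, for `0 < U < n + 2`,
`[Û] · {0̂ (n+2)^} = [0̂] · {Û (n+2)^} + [(n+2)^] · {0̂ Û}`.
It is obtained from the kernel relation `Σ_t (-1)^t [t̂] · (column t) = 0`
(`sum_neg_one_pow_mul_det_succAbove_eq_zero`, Laplace expansion of a matrix with two equal
rows) by substituting the relation into column slot `U - 1` of `{0̂ (n+2)^}` and expanding
multilinearly: all but three terms have a repeated column, and the three survivors are the
displayed minors up to the signs of explicit cyclic column permutations
(`updateCol_first_eq_submatrix_cycleRange`, `updateCol_last_eq_submatrix`).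
If the columns `c` of a `(n+2)`-minor `A[r|c]` are not consecutive, insert a skipped index `η`
to get `n + 3` columns `s ⊇ c`; in the identity for `M = A[r|s]` the five minors other than
`A[r|c]` are either `(n+1)`-minors (rows `r` minus the last one) or `(n+2)`-minors with columns of
smaller dispersion, so their positivity forces `A[r|c] > 0` (`det_submatrix_pos_colStep`); rows
are treated through the transpose. Main statements: `det_submatrix_pos_of_consecutive`
(hypothesis on `IsConsec` selections) and `det_submatrix_pos_of_contiguous` (hypothesis on the
explicit blocks `A[i₀ .. i₀+k-1 | j₀ .. j₀+k-1]`).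

## References

* O. M. Katkova, *Multiple positivity and the Riemann zeta-function*, Comput. Methods Funct.
  Theory 7 (2007) 13–31; arXiv:math/0505174, §2, Thm. D. [Katkova2006]
* S. M. Fallat, C. R. Johnson, *Totally Nonnegative Matrices*, Princeton UP 2011, §3.1,
  Cor. 3.1.5 (Fekete [Fek13]) and Cor. 3.1.6, p. 77. [FallatJohnson2011]
* I. J. Schoenberg, *On the zeros of the generating functions of multiply positive sequences
  and functions*, Ann. of Math. 62 (1955) 447–471 (Katkova's [schoenb]).
* M. Fekete, G. Pólya, *Über ein Problem von Laguerre*, Rend. Circ. Mat. Palermo 34 (1912)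
  89–120.
-/

namespace Literature.Analysis.TotalPositivity

open Matrix Finset

/-! ### A three-term Plücker identity -/

section ThreeTerm

variable {R : Type*} {n : ℕ}

/-- **Kernel relation**: for an `(n+2) × (n+3)` matrix `M` and each row `i`,
`Σ_t (-1)^t M_{i t} [t̂] = 0`, `[t̂]` the maximal minor omitting column `t` (Laplace expansion
along the first row of the square matrix obtained by putting a copy of row `i` on top of `M`,
which has two equal rows). [folklore] -/
theorem sum_neg_one_pow_mul_det_succAbove_eq_zero [CommRing R]
    (M : Matrix (Fin (n + 2)) (Fin (n + 3)) R) (i : Fin (n + 2)) :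
    ∑ t : Fin (n + 3), (-1 : R) ^ (t : ℕ) * M i t * (M.submatrix id t.succAbove).det = 0 := by
  set N : Matrix (Fin (n + 3)) (Fin (n + 3)) R :=
    Matrix.of (Fin.cons (α := fun _ => Fin (n + 3) → R) (M i) fun j => M j) with hN
  have hdet : N.det = 0 := by
    refine Matrix.det_zero_of_row_eq (i := (0 : Fin (n + 3))) (j := i.succ)
      (Fin.succ_ne_zero i).symm ?_
    ext t
    simp [hN]
  rw [Matrix.det_succ_row_zero] at hdet
  rw [← hdet]
  refine Finset.sum_congr rfl fun t _ => ?_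
  have h1 : N 0 t = M i t := by simp [hN]
  have h2 : N.submatrix Fin.succ t.succAbove = M.submatrix id t.succAbove := by
    ext a b; simp [hN]
  rw [h1, h2]

/-- The value of `Fin.succAbove`. [folklore] -/
theorem val_succAbove {m : ℕ} (p : Fin (m + 1)) (i : Fin m) :
    ((p.succAbove i : Fin (m + 1)) : ℕ) = if (i : ℕ) < p then (i : ℕ) else i + 1 := by
  by_cases h : (i : ℕ) < p
  · rw [if_pos h, Fin.succAbove_of_castSucc_lt p i (Fin.lt_def.2 h)]
    rfl
  · rw [if_neg h, Fin.succAbove_of_le_castSucc p i (Fin.le_def.2 (not_lt.1 h))]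
    simp

/-- Putting column `0` of `M` into slot `u` of the block of columns `1, …, n+1` (first `n + 1`
rows) is, up to the cyclic permutation `Fin.cycleRange u` of the columns, the block of columns
`{0, …, n+1} ∖ {u+1}`. [folklore] -/
theorem updateCol_first_eq_submatrix_cycleRange (M : Matrix (Fin (n + 2)) (Fin (n + 3)) R)
    (u : Fin (n + 1)) :
    (M.submatrix Fin.castSucc (fun j : Fin (n + 1) => j.succ.castSucc)).updateCol u
        (fun i => M i.castSucc 0) =
      (M.submatrix Fin.castSucc (Fin.castSucc ∘ u.succ.succAbove)).submatrix id
        (Fin.cycleRange u) := by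
  ext k j
  simp only [Matrix.updateCol_apply, Matrix.submatrix_apply, id, Function.comp_apply]
  rcases lt_trichotomy j u with h | h | h
  · rw [if_neg h.ne, Fin.cycleRange_of_lt h]
    have hj : (j : ℕ) < u := h
    have hval : ((j + 1 : Fin (n + 1)) : ℕ) = j + 1 :=
      Fin.val_add_one_of_lt (lt_of_lt_of_le h (Fin.le_last u))
    congr 1
    apply Fin.ext
    simp only [Fin.val_castSucc, Fin.val_succ, val_succAbove, hval]
    split_ifs <;> omega
  · have hidx :
        Fin.castSucc ((Fin.succ u).succAbove (Fin.cycleRange u u)) = (0 : Fin (n + 3)) := by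
      rw [Fin.cycleRange_self]
      apply Fin.ext
      simp
    rw [h, if_pos rfl, hidx]
  · rw [if_neg h.ne', Fin.cycleRange_of_gt h]
    have hj : (u : ℕ) < j := h
    congr 1
    apply Fin.ext
    simp only [Fin.val_castSucc, Fin.val_succ, val_succAbove]
    split_ifs <;> omega

/-- Putting the last column `n + 2` of `M` into slot `u` of the block of columns `1, …, n+1`
(first `n + 1` rows) is, up to a cyclic permutation of the columns (a conjugate of
`Fin.cycleRange` by `Fin.rev`), the block of columns `{1, …, n+2} ∖ {u+1}`. [folklore] -/
theorem updateCol_last_eq_submatrix (M : Matrix (Fin (n + 2)) (Fin (n + 3)) R)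
    (u : Fin (n + 1)) :
    (M.submatrix Fin.castSucc (fun j : Fin (n + 1) => j.succ.castSucc)).updateCol u
        (fun i => M i.castSucc (Fin.last (n + 2))) =
      (M.submatrix Fin.castSucc (Fin.succ ∘ u.castSucc.succAbove)).submatrix id
        ((Fin.revPerm.trans (Fin.cycleRange u.rev)).trans Fin.revPerm) := by
  ext k j
  simp only [Matrix.updateCol_apply, Matrix.submatrix_apply, id, Function.comp_apply,
    Equiv.trans_apply, Fin.revPerm_apply]
  have hu : (u : ℕ) ≤ n := Nat.lt_succ_iff.1 u.2
  rcases lt_trichotomy j u with h | h | h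
  · rw [if_neg h.ne, Fin.cycleRange_of_gt (Fin.rev_lt_rev.2 h), Fin.rev_rev]
    have hj : (j : ℕ) < u := h
    congr 1
    apply Fin.ext
    simp only [Fin.val_castSucc, Fin.val_succ, val_succAbove]
    rw [if_pos hj]
  · have hidx : Fin.succ ((Fin.castSucc u).succAbove (Fin.rev (Fin.cycleRange u.rev u.rev))) =
        Fin.last (n + 2) := by
      rw [Fin.cycleRange_self, Fin.rev_zero]
      apply Fin.ext
      simp only [Fin.val_last, Fin.val_succ, val_succAbove, Fin.val_castSucc]
      split_ifs <;> omega
    rw [h, if_pos rfl, hidx]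
  · rw [if_neg h.ne']
    have hj : (u : ℕ) < j := h
    have hjn : (j : ℕ) ≤ n := Nat.lt_succ_iff.1 j.2
    have h1 : Fin.cycleRange u.rev j.rev = j.rev + 1 := Fin.cycleRange_of_lt (Fin.rev_lt_rev.2 h)
    have h2 : ((j.rev + 1 : Fin (n + 1)) : ℕ) = (j.rev : ℕ) + 1 :=
      Fin.val_add_one_of_lt (lt_of_lt_of_le (Fin.rev_lt_rev.2 h) (Fin.le_last _))
    rw [h1]
    congr 1
    apply Fin.ext
    simp only [Fin.val_castSucc, Fin.val_succ, val_succAbove, Fin.val_rev, h2]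
    split_ifs <;> omega

/-- Any index of `Fin (n + 3)` other than `0` and `last` is `u.succ.castSucc`, `u : Fin (n + 1)`.
[folklore] -/
theorem exists_eq_succ_castSucc {t : Fin (n + 3)} (h0 : t ≠ 0) (hl : t ≠ Fin.last (n + 2)) :
    ∃ u : Fin (n + 1), t = u.succ.castSucc := by
  have h0' : (t : ℕ) ≠ 0 := fun h => h0 (Fin.ext h)
  have hl' : (t : ℕ) ≠ n + 2 := fun h => hl (Fin.ext h)
  refine ⟨⟨(t : ℕ) - 1, by omega⟩, Fin.ext ?_⟩
  simp only [Fin.val_castSucc, Fin.val_succ]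
  omega

/-- **Three-term identity** (a Plücker relation between the maximal minors of an
`(n+2) × (n+3)` matrix `M` and the maximal minors of its first `n + 1` rows): writing `[t̂]` for
the `(n+2)`-minor of `M` omitting column `t` and `{t̂ t̂'}` for the `(n+1)`-minor of the first
`n + 1` rows omitting columns `t < t'` (remaining columns in increasing order), for
`U = u + 1 ∈ {1, …, n+1}`:
`[Û]·{0̂ (n+2)^} = [0̂]·{Û (n+2)^} + [(n+2)^]·{0̂ Û}`. Columns are addressed by the order
embeddings `U.succAbove` (omit `U`), `Fin.succ` (omit `0`), `Fin.castSucc` (omit `n + 2`),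
`j ↦ j + 1` (omit `0, n+2`), `castSucc ∘ (u+1).succAbove` (omit `U, n+2`) and
`succ ∘ u.succAbove` (omit `0, U`). [folklore] -/
theorem det_mul_det_eq_add [CommRing R] (M : Matrix (Fin (n + 2)) (Fin (n + 3)) R)
    (u : Fin (n + 1)) :
    (M.submatrix id u.succ.castSucc.succAbove).det *
        (M.submatrix Fin.castSucc (fun j : Fin (n + 1) => j.succ.castSucc)).det =
      (M.submatrix id Fin.succ).det *
          (M.submatrix Fin.castSucc (Fin.castSucc ∘ u.succ.succAbove)).det +
        (M.submatrix id Fin.castSucc).det *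
          (M.submatrix Fin.castSucc (Fin.succ ∘ u.castSucc.succAbove)).det := by
  classical
  -- notation
  set big : Fin (n + 3) → R := fun t => (M.submatrix id t.succAbove).det with hbig
  set T : Matrix (Fin (n + 1)) (Fin (n + 1)) R :=
    M.submatrix Fin.castSucc (fun j : Fin (n + 1) => j.succ.castSucc) with hT
  set col : Fin (n + 3) → Fin (n + 1) → R := fun t i => M i.castSucc t with hcol
  -- (1) the kernel relation, as a vector identity on the first `n + 1` rows
  have hker : ∑ t : Fin (n + 3), ((-1 : R) ^ (t : ℕ) * big t) • col t = 0 := by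
    funext i'
    simp only [Finset.sum_apply, Pi.smul_apply, smul_eq_mul, Pi.zero_apply]
    have := sum_neg_one_pow_mul_det_succAbove_eq_zero M i'.castSucc
    rw [← this]
    refine Finset.sum_congr rfl fun t _ => ?_
    simp only [hcol, hbig]
    ring
  -- (2) expand `det (T with column u replaced by the kernel combination) = 0` multilinearly
  have hlin : ∀ s : Finset (Fin (n + 3)),
      (T.updateCol u (∑ t ∈ s, ((-1 : R) ^ (t : ℕ) * big t) • col t)).det =
        ∑ t ∈ s, ((-1 : R) ^ (t : ℕ) * big t) * (T.updateCol u (col t)).det := by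
    intro s
    induction s using Finset.induction_on with
    | empty =>
      simp only [Finset.sum_empty]
      exact Matrix.det_eq_zero_of_column_eq_zero u fun i => by simp
    | insert a s ha ih =>
      rw [Finset.sum_insert ha, Finset.sum_insert ha, Matrix.det_updateCol_add,
        Matrix.det_updateCol_smul, ih]
  have hsum :
      ∑ t : Fin (n + 3), ((-1 : R) ^ (t : ℕ) * big t) * (T.updateCol u (col t)).det = 0 := by
    rw [← hlin Finset.univ, hker]
    exact Matrix.det_eq_zero_of_column_eq_zero u fun i => by simp
  -- (3) only the terms `t = 0`, `t = U`, `t = last` survive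
  have hzero : ∀ t : Fin (n + 3), t ≠ 0 → t ≠ u.succ.castSucc → t ≠ Fin.last (n + 2) →
      (T.updateCol u (col t)).det = 0 := by
    intro t h0 hU hl
    obtain ⟨j, rfl⟩ := exists_eq_succ_castSucc h0 hl
    have hju : j ≠ u := by
      rintro rfl
      exact hU rfl
    refine Matrix.det_zero_of_column_eq hju fun k => ?_
    simp [Matrix.updateCol_ne hju, Matrix.updateCol_self, hT, hcol]
  have hU0 : u.succ.castSucc ≠ (0 : Fin (n + 3)) := fun h => by
    have := congrArg Fin.val h
    simp at this
  have hUl : u.succ.castSucc ≠ Fin.last (n + 2) := fun h => by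
    have := congrArg Fin.val h
    simp at this
    omega
  have hl0 : Fin.last (n + 2) ≠ 0 := fun h => by
    have := congrArg Fin.val h
    simp at this
  rw [← Finset.add_sum_erase _ _ (Finset.mem_univ (0 : Fin (n + 3))),
    ← Finset.add_sum_erase _ _ (Finset.mem_erase.2 ⟨hU0, Finset.mem_univ _⟩),
    ← Finset.add_sum_erase _ _
      (Finset.mem_erase.2 ⟨hUl.symm, Finset.mem_erase.2 ⟨hl0, Finset.mem_univ _⟩⟩),
    Finset.sum_eq_zero fun t ht => ?_] at hsum
  swap
  · simp only [Finset.mem_erase] at ht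
    rw [hzero t ht.2.2.1 ht.2.1 ht.1, mul_zero]
  -- (4) evaluate the three surviving terms
  have hBU : T.updateCol u (col (u.succ.castSucc)) = T := by
    rw [hcol, hT]
    exact Matrix.updateCol_eq_self _ u
  have hB0 : (T.updateCol u (col 0)).det =
      (-1 : R) ^ (u : ℕ) *
        (M.submatrix Fin.castSucc (Fin.castSucc ∘ u.succ.succAbove)).det := by
    rw [hT, hcol, updateCol_first_eq_submatrix_cycleRange M u, Matrix.det_permute',
      Fin.sign_cycleRange]
    simp
  have hBl : (T.updateCol u (col (Fin.last (n + 2)))).det =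
      (-1 : R) ^ (n - u : ℕ) *
        (M.submatrix Fin.castSucc (Fin.succ ∘ u.castSucc.succAbove)).det := by
    rw [hT, hcol, updateCol_last_eq_submatrix M u, Matrix.det_permute', Equiv.Perm.sign_trans,
      Equiv.Perm.sign_trans, Fin.sign_cycleRange, Fin.val_rev, Nat.add_sub_add_right]
    have hsign : ∀ a b : ℤˣ, a * (b * a) = b := fun a b => by
      rw [mul_left_comm, Int.units_mul_self, mul_one]
    rw [hsign]
    simp
  rw [hBU, hB0, hBl, add_zero] at hsum
  simp only [hbig, Fin.val_zero, pow_zero, one_mul, Fin.val_castSucc, Fin.val_succ, Fin.val_last,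
    Fin.succAbove_zero, Fin.succAbove_last] at hsum
  have hε : ((-1 : R) ^ (u : ℕ)) * (-1) ^ (u : ℕ) = 1 := by
    rw [← pow_add, ← two_mul, pow_mul]
    simp
  have hε2 : (-1 : R) ^ (n + 2) * (-1) ^ (n - u : ℕ) = (-1) ^ (u : ℕ) := by
    rw [← pow_add, show n + 2 + (n - u) = u + 2 * (n - u + 1) by omega, pow_add, pow_mul]
    simp
  have hε1 : (-1 : R) ^ ((u : ℕ) + 1) = -(-1) ^ (u : ℕ) := by
    rw [pow_succ]
    ring
  rw [hε1] at hsum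
  linear_combination (-(-1 : R) ^ (u : ℕ)) * hsum +
    ((M.submatrix id Fin.succ).det *
          (M.submatrix Fin.castSucc (Fin.castSucc ∘ u.succ.succAbove)).det -
        (M.submatrix id u.succ.castSucc.succAbove).det * T.det +
      (M.submatrix id Fin.castSucc).det *
        (M.submatrix Fin.castSucc (Fin.succ ∘ u.castSucc.succAbove)).det) * hε +
    ((-1 : R) ^ (u : ℕ) * (M.submatrix id Fin.castSucc).det *
      (M.submatrix Fin.castSucc (Fin.succ ∘ u.castSucc.succAbove)).det) * hε2

end ThreeTerm

/-! ### Fekete's criterion -/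

section Fekete

variable {R : Type*} [CommRing R] [LinearOrder R] [IsStrictOrderedRing R]

/-- A selection `c : Fin k → Fin q` of indices is *consecutive* ("composed of consecutive
rows/columns" [Katkova2006, §2 Thm. D]; "contiguous" [FallatJohnson2011, §3.1]): `c i = c 0 + i`,
written without subtraction as `c i + j = c j + i`. [cite: Katkova2006, §2 Thm. D] -/
def IsConsec {k q : ℕ} (c : Fin k → Fin q) : Prop :=
  ∀ i j : Fin k, (c i : ℕ) + j = (c j : ℕ) + i

omit [LinearOrder R] [IsStrictOrderedRing R] in
/-- A consecutive selection is strictly increasing. [folklore] -/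
theorem IsConsec.strictMono {k q : ℕ} {c : Fin k → Fin q} (h : IsConsec c) : StrictMono c := by
  intro i j hij
  have := h i j
  rw [Fin.lt_def] at hij ⊢
  omega

/-- Selections of one index are consecutive. [folklore] -/
theorem isConsec_one {q : ℕ} (c : Fin 1 → Fin q) : IsConsec c := fun i j => by
  rw [Subsingleton.elim i j]

/-- The explicit consecutive selection `i ↦ i₀ + i`. [folklore] -/
theorem isConsec_mk_add {k q i₀ : ℕ} (h : ∀ i : Fin k, i₀ + i < q) :
    IsConsec (fun i : Fin k => (⟨i₀ + i, h i⟩ : Fin q)) := by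
  intro i j
  simp only
  omega

/-- A consecutive selection is `i ↦ c 0 + i`. [folklore] -/
theorem IsConsec.val_eq {k q : ℕ} {c : Fin (k + 1) → Fin q} (h : IsConsec c) (i : Fin (k + 1)) :
    (c i : ℕ) = c 0 + i := by
  have := h i 0
  simp at this
  omega

/-- The *dispersion* of a selection of `n + 2` indices: the number of skipped indices between
the first and the last one (for strictly increasing selections); `0` iff the selection is
consecutive. [folklore] -/
def disp {n q : ℕ} (c : Fin (n + 2) → Fin q) : ℕ :=
  (c (Fin.last (n + 1)) : ℕ) - (c 0 : ℕ) - (n + 1)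

/-- Strictly increasing selections grow at least like the index. [folklore] -/
theorem strictMono_val_add_le {k q : ℕ} {c : Fin k → Fin q} (hc : StrictMono c) :
    ∀ (d : ℕ) (i j : Fin k), (j : ℕ) = i + d → (c i : ℕ) + d ≤ c j := by
  intro d
  induction d with
  | zero =>
    intro i j h
    have hij : j = i := Fin.ext (by simpa using h)
    rw [hij]
    simp
  | succ d ih =>
    intro i j h
    have hj : (i : ℕ) + d < k := by omega
    have h1 := ih i ⟨i + d, hj⟩ rfl
    have h2 : c ⟨i + d, hj⟩ < c j := hc (Fin.lt_def.2 (by simp; omega))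
    rw [Fin.lt_def] at h2
    omega

/-- A strictly increasing, non-consecutive selection has a gap of size `≥ 2` between two
successive indices. [folklore] -/
theorem exists_gap {n q : ℕ} {c : Fin (n + 2) → Fin q} (hc : StrictMono c) (h : ¬ IsConsec c) :
    ∃ i : Fin (n + 1), (c i.castSucc : ℕ) + 1 < c i.succ := by
  by_contra hcon
  simp only [not_exists, not_lt] at hcon
  apply h
  have step : ∀ i : Fin (n + 1), (c i.succ : ℕ) = c i.castSucc + 1 := fun i =>
    le_antisymm (hcon i) (Nat.succ_le_of_lt (Fin.lt_def.1 (hc (Fin.castSucc_lt_succ (i := i)))))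
  have key : ∀ j : Fin (n + 2), (c j : ℕ) = c 0 + j := by
    intro j
    induction j using Fin.induction with
    | zero => simp
    | succ i ih =>
      rw [step i, ih]
      simp [Fin.val_succ]
      ring
  intro i j
  rw [key i, key j]
  ring

omit [LinearOrder R] [IsStrictOrderedRing R] in
/-- Transposition swaps the roles of the two selections of a minor. [folklore] -/
theorem det_submatrix_transpose {p q k : ℕ} (A : Matrix (Fin p) (Fin q) R) (r : Fin k → Fin p)
    (c : Fin k → Fin q) : (A.transpose.submatrix c r).det = (A.submatrix r c).det := by
  rw [← Matrix.transpose_submatrix, Matrix.det_transpose]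

/-- **The column step of Fekete's induction**: if the columns `c` of an `(n+2)`-minor `A[r|c]`
are strictly increasing but not consecutive, insert a skipped column index `η = c i + 1` to get
`n + 3` columns `s ⊇ c` (`s` the increasing enumeration of `range c ∪ {η}`,
`Finset.orderEmbOfFin`); the three-term identity `det_mul_det_eq_add` for `M = A[r|s]`
expresses `A[r|c] · A[r'|s₁…s_{n+1}]` (`r' = r` minus its last row) as a sum of two products of
an `(n+2)`-minor with rows `r` and columns of smaller dispersion by an `(n+1)`-minor with rows
`r'`; positivity of those four minors and of `A[r'|s₁…s_{n+1}]` forces `A[r|c] > 0`.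
[FallatJohnson2011, §3.1 (Fekete's criterion)] [folklore] -/
theorem det_submatrix_pos_colStep {p q n : ℕ} (A : Matrix (Fin p) (Fin q) R)
    (r : Fin (n + 2) → Fin p) {c : Fin (n + 2) → Fin q} (hc : StrictMono c)
    (hnc : ¬ IsConsec c)
    (hsmall : ∀ c' : Fin (n + 1) → Fin q, StrictMono c' →
      0 < (A.submatrix (r ∘ Fin.castSucc) c').det)
    (hbig : ∀ c' : Fin (n + 2) → Fin q, StrictMono c' → disp c' < disp c →
      0 < (A.submatrix r c').det) :
    0 < (A.submatrix r c).det := by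
  classical
  obtain ⟨i, hi⟩ := exists_gap hc hnc
  -- the inserted column index `η = c i + 1`
  set η : Fin q := ⟨(c i.castSucc : ℕ) + 1, lt_trans hi (c i.succ).2⟩ with hη
  have hη_ne : ∀ j, c j ≠ η := by
    intro j hj
    have h1 : c i.castSucc < c j := by
      rw [hj, Fin.lt_def]
      simp [hη]
    have h2 : c j < c i.succ := by
      rw [hj, Fin.lt_def]
      exact hi
    have h1' := Fin.lt_def.1 (hc.lt_iff_lt.1 h1)
    have h2' := Fin.lt_def.1 (hc.lt_iff_lt.1 h2)
    simp only [Fin.val_castSucc, Fin.val_succ] at h1' h2'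
    omega
  -- the enlarged column set `S = range c ∪ {η}` and its increasing enumeration `s`
  set S : Finset (Fin q) := insert η (Finset.univ.image c) with hS
  have hcardT : (Finset.univ.image c).card = n + 2 := by
    rw [Finset.card_image_of_injective _ hc.injective]
    simp
  have hηT : η ∉ Finset.univ.image c := by
    simpa [Finset.mem_image] using fun j => hη_ne j
  have hcard : S.card = n + 3 := by
    rw [hS, Finset.card_insert_of_notMem hηT, hcardT]
  set s : Fin (n + 3) → Fin q := ⇑(S.orderEmbOfFin hcard) with hs_def
  have hs : StrictMono s := (S.orderEmbOfFin hcard).strictMono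
  have hrange : Set.range s = ↑S := Finset.range_orderEmbOfFin S hcard
  obtain ⟨U, hU⟩ : ∃ U, s U = η := by
    have : η ∈ Set.range s := by
      rw [hrange]
      simp [hS]
    exact this
  -- `c` is `s` with the position `U` of `η` skipped
  have hsc : s ∘ U.succAbove = c := by
    have e1 : (s ∘ U.succAbove) = ⇑((Finset.univ.image c).orderEmbOfFin hcardT) := by
      refine Finset.orderEmbOfFin_unique hcardT (fun x => ?_)
        (hs.comp (Fin.strictMono_succAbove U))
      have hxS : s (U.succAbove x) ∈ S := Finset.orderEmbOfFin_mem S hcard _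
      rw [hS, Finset.mem_insert] at hxS
      rcases hxS with h | h
      · exact absurd (hs.injective (h.trans hU.symm)) (Fin.succAbove_ne U x)
      · exact h
    have e2 : c = ⇑((Finset.univ.image c).orderEmbOfFin hcardT) :=
      Finset.orderEmbOfFin_unique hcardT (fun x => Finset.mem_image_of_mem c (Finset.mem_univ x))
        hc
    rw [e1, ← e2]
  have hmemc : ∀ j, ∃ y, s y = c j := fun j => by
    have : c j ∈ Set.range s := by
      rw [hrange]
      simp [hS]
    exact this
  have hU0 : U ≠ 0 := by
    rintro rfl
    obtain ⟨y, hy⟩ := hmemc 0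
    have h1 : s 0 ≤ s y := hs.monotone (Fin.zero_le y)
    rw [hU, hy, Fin.le_def] at h1
    have h2 : c 0 ≤ c i.castSucc := hc.monotone (Fin.zero_le _)
    rw [Fin.le_def] at h2
    simp [hη] at h1
    omega
  have hUl : U ≠ Fin.last (n + 2) := by
    rintro rfl
    obtain ⟨y, hy⟩ := hmemc (Fin.last (n + 1))
    have h1 : s y ≤ s (Fin.last (n + 2)) := hs.monotone (Fin.le_last y)
    rw [hU, hy, Fin.le_def] at h1
    have h2 : c i.succ ≤ c (Fin.last (n + 1)) := hc.monotone (Fin.le_last _)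
    rw [Fin.le_def] at h2
    simp [hη] at h1
    omega
  obtain ⟨u, rfl⟩ := exists_eq_succ_castSucc hU0 hUl
  -- endpoints of `s`
  have hs0 : s 0 = c 0 := by
    have := congrFun hsc 0
    rw [Function.comp_apply, Fin.succAbove_ne_zero_zero hU0] at this
    exact this
  have hsl : s (Fin.last (n + 2)) = c (Fin.last (n + 1)) := by
    have := congrFun hsc (Fin.last (n + 1))
    rw [Function.comp_apply, Fin.succAbove_ne_last_last hUl] at this
    exact this
  have hs01 : s 0 < s 1 := hs (by simp)  -- Fin.zero_lt_one
  have hsl' : s (Fin.last (n + 1)).castSucc < s (Fin.last (n + 2)) := hs (by simp [Fin.lt_def])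
  -- the identity
  have hid := det_mul_det_eq_add (A.submatrix r s) u
  simp only [Matrix.submatrix_submatrix, Function.comp_id] at hid
  rw [hsc] at hid
  -- positivity of the five other minors
  have P1 :
      0 < (A.submatrix (r ∘ Fin.castSucc) (s ∘ fun j : Fin (n + 1) => j.succ.castSucc)).det :=
    hsmall _ (hs.comp (Fin.strictMono_castSucc.comp Fin.strictMono_succ))
  have P3 :
      0 < (A.submatrix (r ∘ Fin.castSucc) (s ∘ (Fin.castSucc ∘ u.succ.succAbove))).det :=
    hsmall _ (hs.comp (Fin.strictMono_castSucc.comp (Fin.strictMono_succAbove _)))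
  have P5 :
      0 < (A.submatrix (r ∘ Fin.castSucc) (s ∘ (Fin.succ ∘ u.castSucc.succAbove))).det :=
    hsmall _ (hs.comp ((Fin.strictMono_succ).comp (Fin.strictMono_succAbove _)))
  have hmono2 : StrictMono (s ∘ Fin.succ) := hs.comp Fin.strictMono_succ
  have hmono4 : StrictMono (s ∘ Fin.castSucc) := hs.comp Fin.strictMono_castSucc
  have hsl2 : s (Fin.last (n + 1)).succ = c (Fin.last (n + 1)) := by
    rw [Fin.succ_last]
    exact hsl
  have P2 : 0 < (A.submatrix r (s ∘ Fin.succ)).det := by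
    refine hbig _ hmono2 ?_
    have hgrow := strictMono_val_add_le hmono2 (n + 1) 0 (Fin.last (n + 1)) (by simp)
    simp only [Function.comp_apply, Fin.succ_zero_eq_one] at hgrow
    have e0 := congrArg Fin.val hs0
    have el := congrArg Fin.val hsl2
    have e01 := Fin.lt_def.1 hs01
    unfold disp
    simp only [Function.comp_apply, Fin.succ_zero_eq_one]
    omega
  have P4 : 0 < (A.submatrix r (s ∘ Fin.castSucc)).det := by
    refine hbig _ hmono4 ?_
    have hgrow := strictMono_val_add_le hmono4 (n + 1) 0 (Fin.last (n + 1)) (by simp)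
    simp only [Function.comp_apply, Fin.castSucc_zero] at hgrow
    have e0 := congrArg Fin.val hs0
    have el := congrArg Fin.val hsl
    have ell := Fin.lt_def.1 hsl'
    unfold disp
    simp only [Function.comp_apply, Fin.castSucc_zero]
    omega
  have key : 0 < (A.submatrix r c).det *
      (A.submatrix (r ∘ Fin.castSucc) (s ∘ fun j : Fin (n + 1) => j.succ.castSucc)).det := by
    rw [hid]
    exact add_pos (mul_pos P2 P3) (mul_pos P4 P5)
  exact pos_of_mul_pos_left key P1.le

/-- **Fekete's criterion = Katkova's Theorem D** (M. Fekete 1912; Schoenberg 1955), as printed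
in [Katkova2006, §2, Thm. D]: "If all minors of order `ν = 1, 2, …, m` composed of consecutive
rows and consecutive columns of matrix `A` are positive then all minors of `A` of order
`ν = 1, 2, …, m` are positive"; [FallatJohnson2011, Cor. 3.1.5–3.1.6, p. 77]. Here for
`A : Matrix (Fin p) (Fin q) R`, `R` a linearly ordered commutative ring, the hypothesis ranging
over consecutive selections (`IsConsec`) of every order `k ≤ m` and the conclusion over strictly
increasing selections of order `k ≤ m`. Proof: induction on `k` and, for fixed `k = n + 2`, on
the total dispersion `disp r + disp c`, the step being `det_submatrix_pos_colStep` for the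
columns and, through the transpose, for the rows. [cite: Katkova2006, §2 Thm. D] -/
theorem det_submatrix_pos_of_consecutive {p q m : ℕ} (A : Matrix (Fin p) (Fin q) R)
    (h : ∀ k, k ≤ m → ∀ (r : Fin k → Fin p) (c : Fin k → Fin q), IsConsec r →
      IsConsec c → 0 < (A.submatrix r c).det)
    {k : ℕ} (hk : k ≤ m) (r : Fin k → Fin p) (c : Fin k → Fin q) (hr : StrictMono r)
    (hc : StrictMono c) : 0 < (A.submatrix r c).det := by
  induction k with
  | zero =>
    simp [Matrix.det_isEmpty]
  | succ k ih =>
    rcases k with _ | n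
    · exact h 1 hk r c (isConsec_one r) (isConsec_one c)
    · have ih' : ∀ (r : Fin (n + 1) → Fin p) (c : Fin (n + 1) → Fin q), StrictMono r →
          StrictMono c → 0 < (A.submatrix r c).det := fun r c hr hc => ih (by omega) r c hr hc
      suffices H : ∀ (D : ℕ) (r : Fin (n + 2) → Fin p) (c : Fin (n + 2) → Fin q),
          StrictMono r → StrictMono c → disp r + disp c = D → 0 < (A.submatrix r c).det from
        H _ r c hr hc rfl
      intro D
      induction D using Nat.strong_induction_on with
      | _ D IH =>
        intro r c hr hc hD
        by_cases hcc : IsConsec c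
        · by_cases hrr : IsConsec r
          · exact h _ hk r c hrr hcc
          · rw [← det_submatrix_transpose]
            refine det_submatrix_pos_colStep A.transpose c hr hrr (fun r' hr' => ?_)
              (fun r' hr' hlt => ?_)
            · rw [det_submatrix_transpose]
              exact ih' r' _ hr' (hc.comp Fin.strictMono_castSucc)
            · rw [det_submatrix_transpose]
              exact IH _ (by omega) r' c hr' hc rfl
        · exact det_submatrix_pos_colStep A r hc hcc
            (fun c' hc' => ih' _ c' (hr.comp Fin.strictMono_castSucc) hc')
            (fun c' hc' hlt => IH _ (by omega) r c' hr hc' rfl)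

/-- **Fekete's criterion, block form**: if for every `k ≤ m` every CONTIGUOUS block
`A[i₀ … i₀+k-1 | j₀ … j₀+k-1]` has positive determinant, then every minor of `A` of
order `k ≤ m` (rows and columns strictly increasing) is positive. [Katkova2006, §2 Thm. D;
FallatJohnson2011, Cor. 3.1.5–3.1.6] [cite: Katkova2006, §2 Thm. D] -/
theorem det_submatrix_pos_of_contiguous {p q m : ℕ} (A : Matrix (Fin p) (Fin q) R)
    (h : ∀ k, k ≤ m → ∀ (i₀ j₀ : ℕ) (hi : i₀ + k ≤ p) (hj : j₀ + k ≤ q),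
      0 < (A.submatrix (fun i : Fin k => (⟨i₀ + i, by omega⟩ : Fin p))
        (fun j : Fin k => (⟨j₀ + j, by omega⟩ : Fin q))).det)
    {k : ℕ} (hk : k ≤ m) (r : Fin k → Fin p) (c : Fin k → Fin q) (hr : StrictMono r)
    (hc : StrictMono c) : 0 < (A.submatrix r c).det := by
  refine det_submatrix_pos_of_consecutive A (fun k hk r c hr hc => ?_) hk r c hr hc
  rcases k with _ | k
  · simp [Matrix.det_isEmpty]
  · have hi : (r 0 : ℕ) + (k + 1) ≤ p := by
      have h1 := hr.val_eq (Fin.last k)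
      have h2 := (r (Fin.last k)).2
      simp only [Fin.val_last] at h1
      omega
    have hj : (c 0 : ℕ) + (k + 1) ≤ q := by
      have h1 := hc.val_eq (Fin.last k)
      have h2 := (c (Fin.last k)).2
      simp only [Fin.val_last] at h1
      omega
    have er : r = fun i : Fin (k + 1) => (⟨r 0 + i, by omega⟩ : Fin p) :=
      funext fun i => Fin.ext (hr.val_eq i)
    have ec : c = fun j : Fin (k + 1) => (⟨c 0 + j, by omega⟩ : Fin q) :=
      funext fun j => Fin.ext (hc.val_eq j)
    rw [er, ec]
    exact h (k + 1) hk (r 0) (c 0) hi hj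

end Fekete

end Literature.Analysis.TotalPositivity
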